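import Summits.QuantumFields.YangMills.Theorems.BalabanUVNodesN22AtRecord
import Summits.QuantumFields.YangMills.Theorems.BalabanUVNodesN22KnitTwoConstants

/-!
# BalabanUVNodes ∕ node N22 = NE9 — THE «AT-RECORD» CLOSERS OF ROAD 3: `S_N22 RRec` for every rate-record predicate whose U3 bundles carry the
# ANALYTIC slot «(P) + (O) at the bundle's NE5 rate θ + uniform-margin analyticity of the young-coupling sections with bounds growing at ANY
# geometric rate μ» with the rate-`θ^{1−s}μ^{s}` moduli (`BalabanUVNodesN22KnitTwoConstants` BY NAME), and the tower form with node N18 below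
# the level (companion of `BalabanUVNodesN22AtRecord`; plan word (W2))

Cell `pub-ymgap`, HUMAN RULING D-0062 (Track A), seat `pub-ymgap-dag-n22-a` (-a KNIT-BY-NAME), generation 2.  THEOREMS ONLY; imports the seat's
AT-RECORD module (`S_N22` readings ∕ guards ∕ faces) and ROAD 3's headline module.  `--supports stmt-QuantumFields-19182`.

HONEST FRAMING.  By-name bookkeeping; no `RRec` home exists (R422 (A)(P2)), so nothing here discharges N22; NE5 ∕ NE9 NOT IN PRINT, NOT PROVED;
instance on Bałaban's localized `E^{(j)}(X)` 0∕1 (W1); count-neutral; one finite four-torus programme at fixed ε — NOT infinite volume, NOT OS on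
ℝ⁴, NOT a mass gap, NOT Clay.  0 `sorry`, 0 `def`, standard axioms.

WHAT.
* `n22At_of_oscAnalytic` — a U3 bundle with window `Window γ`, (P), (O) with constant `C₀ > 0` at the bundle's rate `θ > 0`, (A) coordinate-disc
  analyticity of every young-coupling section with a uniform margin `r` about `]0, γ]` and bounds `M·μ^{age−1}·e^{−κd(X)}` (`θ ≤ μ`, `C₀ ≤ 2M`), a
  parameter `s ∈ ]0, 1[`, and letters `ω = θ^{1−s}μ^{s}`, `Λ k i = C₉·ω^{k−i}`, `C₉ = (32∕(s²·min(r∕2, γ∕2)))·C₀^{1−s}(2M)^{s}∕ω` carries `N22At`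
  (`N22KnitTwoConstants.ne9_and_fadingMemory_of_osc_analytic_rpow`); **`s_N22_of_oscAnalytic`** — hence `S_N22 RRec` for EVERY `RRec` whose
  bundles carry that slot (combine with `YMDAG.N22.s_N22_of_refines`).
* `n22At_level_of_n18At_below_analytic` — the tower form: the bundle «level `k` of ne9's tower of carriers» with the ROAD-3 letters carries
  `N22At` from `N18At` of the bundles «level `k′ < k`» + (P) + (A) (`…_of_ne5_below_analytic`); **`s_N22_of_towerSlot_analytic`**.
READING (census): on ROAD 3 an instancing `RRec` must carry for N22 — (P) (printed words), (A) = the printed TYPE «(or analytic)» ([Balaban1987RG1]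
p. 263) in EACH young coupling with a uniform complex margin and at-most-geometric bounds (unprinted for the older couplings; body-level: the
phase-cone step `BalabanUVNodesN22KnitPhaseCone` keeps the strip fixed), and EITHER (O) OR the tower identification with N18 below; NO smallness or
growth condition — every fading rate above `θ` is available (`s ↓ 0`).

References (TYPES only): [Balaban1987RG1] = T. Bałaban, Commun. Math. Phys. **109** (1987) 249–301 — p. 256, Thm 1 p. 259, p. 263, p. 298.
-/

noncomputable section

namespace YMDAG.N22

open Set Metric
open scoped BigOperators
open Literature.MathematicalPhysics.QuantumFieldTheory.Balaban1983to89
open Literature.MathematicalPhysics.QuantumFieldTheory.Balaban1983to89.T4Continuum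
open Literature.MathematicalPhysics.QuantumFieldTheory.Balaban1983to89.T4OutputRate
open Summit.QuantumFields.BalabanUV.T4Continuum.NE9.TowerCarriers (TowerData prepend)
open Summit.QuantumFields.YangMills.BalabanUVNodes.N22KnitTwoConstants
  (ne9_and_fadingMemory_of_osc_analytic_rpow ne9_fadingMemory_at_level_of_ne5_below_analytic)
open YMDAG.UVSplit

variable {N : ℕ} [NeZero N]

/-! ## §1 The analytic slot carries `N22At`; `S_N22` for every `RRec` carrying it -/

/-- **THE ANALYTIC SLOT (ROAD 3) CARRIES `N22At`.**  A U3 bundle with window `Window γ`, (P) prefix dependence, (O) oscillation fading with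
constant `C₀ > 0` at the bundle's NE5 rate `θ > 0`, (A) uniform-margin coordinate-disc analyticity of the young-coupling sections with bounds
`M·μ^{scale X − 1 − i}·e^{−κd(X)}` (`θ ≤ μ`, `C₀ ≤ 2M`, margin `r > 0`), a parameter `0 < s < 1`, fading letter `ω = θ^{1−s}μ^{s}` and moduli
`Λ k i = C₉·ω^{k−i}`, `C₉ = (32∕(s²·min(r∕2, γ∕2)))·C₀^{1−s}(2M)^{s}∕ω` carries `N22At` — ROAD 3's headline BY NAME; no growth condition on `μ`. [folklore] -/
theorem n22At_of_oscAnalytic (u : U3Carriers) {C₀ M μ r s : ℝ} (hW : u.W = Window u.γ)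
    (hP : PrefixDependenceOn u.EA (Window u.γ))
    (hO : ∀ g ∈ Window u.γ, ∀ g' ∈ Window u.γ, ∀ (U : u.C.BgA) (X : u.C.Dom) (a : ℕ), a ≤ u.C.scale X →
      (∀ n, a ≤ n → g n = g' n) → |u.EA g U X - u.EA g' U X| ≤ C₀ * u.θ ^ (u.C.scale X - a) * Real.exp (-(u.κ * u.C.d X)))
    (hA : ∀ g ∈ Window u.γ, ∀ (U : u.C.BgA) (X : u.C.Dom) (i : ℕ), i < u.C.scale X → ∃ (F : ℂ → ℂ) (Dset : Set ℂ),
      DifferentiableOn ℂ F Dset ∧ (∀ z ∈ Dset, ‖F z‖ ≤ M * μ ^ (u.C.scale X - 1 - i) * Real.exp (-(u.κ * u.C.d X))) ∧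
      (∀ t ∈ Ioc (0 : ℝ) u.γ, closedBall (t : ℂ) r ⊆ Dset) ∧ (∀ t ∈ Ioc (0 : ℝ) u.γ, F t = (u.EA (Function.update g i t) U X : ℂ)))
    (hC₀ : 0 < C₀) (hθ : 0 < u.θ) (hM : 0 < M) (hθμ : u.θ ≤ μ) (hCM : C₀ ≤ 2 * M) (hr : 0 < r) (hγ : 0 < u.γ) (hs0 : 0 < s) (hs1 : s < 1)
    (hω : u.ω = u.θ ^ (1 - s) * μ ^ s) (hΛ : u.Λ = fun k i => u.C₉ * u.ω ^ (k - i))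
    (hC₉ : u.C₉ = 32 / (s ^ 2 * min (r / 2) (u.γ / 2)) * (C₀ ^ (1 - s) * (2 * M) ^ s) / (u.θ ^ (1 - s) * μ ^ s)) :
    N22At u := by
  show NE9 u.EA u.W u.κ u.Λ ∧ FadingMemory u.C₉ u.ω u.Λ
  rw [hW, hΛ, hC₉, hω]
  exact ne9_and_fadingMemory_of_osc_analytic_rpow hP hO hA hC₀ hθ hM hθμ hCM hr hγ hs0 hs1

/-- **`S_N22 RRec` FOR EVERY `RRec` WHOSE BUNDLES CARRY THE ANALYTIC SLOT** (refinement-generic; with `s_N22_of_refines` one application of a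
refinement lemma closes any refinement). [folklore] -/
theorem s_N22_of_oscAnalytic (RRec : RateRecordPred N)
    (hslot : ∀ (F : T4Family) (D : Datum F N) (g₀ : ℕ → ℝ) (os : List (ULoop F)) (R : RateCarriers N), RRec F D g₀ os R →
      ∃ C₀ M μ r s : ℝ, R.u3.W = Window R.u3.γ ∧ PrefixDependenceOn R.u3.EA (Window R.u3.γ) ∧
        (∀ g ∈ Window R.u3.γ, ∀ g' ∈ Window R.u3.γ, ∀ (U : R.u3.C.BgA) (X : R.u3.C.Dom) (a : ℕ), a ≤ R.u3.C.scale X →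
          (∀ n, a ≤ n → g n = g' n) →
            |R.u3.EA g U X - R.u3.EA g' U X| ≤ C₀ * R.u3.θ ^ (R.u3.C.scale X - a) * Real.exp (-(R.u3.κ * R.u3.C.d X))) ∧
        (∀ g ∈ Window R.u3.γ, ∀ (U : R.u3.C.BgA) (X : R.u3.C.Dom) (i : ℕ), i < R.u3.C.scale X → ∃ (Fz : ℂ → ℂ) (Dset : Set ℂ),
          DifferentiableOn ℂ Fz Dset ∧ (∀ z ∈ Dset, ‖Fz z‖ ≤ M * μ ^ (R.u3.C.scale X - 1 - i) * Real.exp (-(R.u3.κ * R.u3.C.d X))) ∧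
          (∀ t ∈ Ioc (0 : ℝ) R.u3.γ, closedBall (t : ℂ) r ⊆ Dset) ∧
          (∀ t ∈ Ioc (0 : ℝ) R.u3.γ, Fz t = (R.u3.EA (Function.update g i t) U X : ℂ))) ∧
        0 < C₀ ∧ 0 < R.u3.θ ∧ 0 < M ∧ R.u3.θ ≤ μ ∧ C₀ ≤ 2 * M ∧ 0 < r ∧ 0 < R.u3.γ ∧ 0 < s ∧ s < 1 ∧
        R.u3.ω = R.u3.θ ^ (1 - s) * μ ^ s ∧ (R.u3.Λ = fun k i => R.u3.C₉ * R.u3.ω ^ (k - i)) ∧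
        R.u3.C₉ = 32 / (s ^ 2 * min (r / 2) (R.u3.γ / 2)) * (C₀ ^ (1 - s) * (2 * M) ^ s) / (R.u3.θ ^ (1 - s) * μ ^ s)) :
    S_N22 RRec := by
  intro F D g₀ os R hR
  obtain ⟨C₀, M, μ, r, s, hW, hP, hO, hA, hC₀, hθ, hM, hθμ, hCM, hr, hγ, hs0, hs1, hω, hΛ, hC₉⟩ := hslot F D g₀ os R hR
  exact n22At_of_oscAnalytic R.u3 hW hP hO hA hC₀ hθ hM hθμ hCM hr hγ hs0 hs1 hω hΛ hC₉

/-! ## §2 The tower form: node N18 below the level + (P) + analyticity -/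

/-- **ROAD 3 ALONG THE TOWER, AT THE RECORD'S BUNDLES**: the bundle «level `k` of ne9's tower of carriers» with the ROAD-3 letters
(`ω = θ^{1−s}μ^{s}`, `Λ a i = C₉·ω^{a−i}`, `C₉ = (32∕(s²·min(r∕2, γ∕2)))·(2C₅∕(1−θ))^{1−s}(2M)^{s}∕ω`) carries `N22At` as soon as the bundles
«level `k′`», `k′ < k`, carry `N18At` (node N18 BY NAME; `C₅ > 0`, `0 < θ < 1`) and `E k` has (P) and the uniform-margin analyticity letter with
bounds `M·μ^{age−1}·e^{−κd}` (`θ ≤ μ`, `2C₅∕(1−θ) ≤ 2M`). [folklore] -/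
theorem n22At_level_of_n18At_below_analytic (T : TowerData) (E : ℕ → (ℕ → ℝ) → T.B → T.Dom → ℝ) {γ κ θ C₅ M μ r s cr ρ' : ℝ}
    (hC : 0 < C₅) (hθ0 : 0 < θ) (hθ1 : θ < 1) (k : ℕ)
    (h18 : ∀ k' : ℕ, k' < k →
      N18At ⟨T.level k', Window γ, γ, κ, E k', fun b g U X => E (k' + 1) (prepend b g) U X, θ, C₅,
        fun a i => 32 / (s ^ 2 * min (r / 2) (γ / 2)) * ((2 * C₅ / (1 - θ)) ^ (1 - s) * (2 * M) ^ s) / (θ ^ (1 - s) * μ ^ s)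
          * (θ ^ (1 - s) * μ ^ s) ^ (a - i),
        32 / (s ^ 2 * min (r / 2) (γ / 2)) * ((2 * C₅ / (1 - θ)) ^ (1 - s) * (2 * M) ^ s) / (θ ^ (1 - s) * μ ^ s),
        θ ^ (1 - s) * μ ^ s, cr, ρ'⟩)
    (hP : PrefixDependenceOn (C := T.level k) (E k) (Window γ))
    (hA : ∀ g ∈ Window γ, ∀ (U : (T.level k).BgA) (X : (T.level k).Dom) (i : ℕ), i < (T.level k).scale X → ∃ (F : ℂ → ℂ) (Dset : Set ℂ),
      DifferentiableOn ℂ F Dset ∧ (∀ z ∈ Dset, ‖F z‖ ≤ M * μ ^ ((T.level k).scale X - 1 - i) * Real.exp (-(κ * (T.level k).d X))) ∧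
      (∀ t ∈ Ioc (0 : ℝ) γ, closedBall (t : ℂ) r ⊆ Dset) ∧ (∀ t ∈ Ioc (0 : ℝ) γ, F t = (E k (Function.update g i t) U X : ℂ)))
    (hM : 0 < M) (hθμ : θ ≤ μ) (hCM : 2 * C₅ / (1 - θ) ≤ 2 * M) (hr : 0 < r) (hγ : 0 < γ) (hs0 : 0 < s) (hs1 : s < 1) :
    N22At ⟨T.level k, Window γ, γ, κ, E k, fun b g U X => E (k + 1) (prepend b g) U X, θ, C₅,
      fun a i => 32 / (s ^ 2 * min (r / 2) (γ / 2)) * ((2 * C₅ / (1 - θ)) ^ (1 - s) * (2 * M) ^ s) / (θ ^ (1 - s) * μ ^ s)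
        * (θ ^ (1 - s) * μ ^ s) ^ (a - i),
      32 / (s ^ 2 * min (r / 2) (γ / 2)) * ((2 * C₅ / (1 - θ)) ^ (1 - s) * (2 * M) ^ s) / (θ ^ (1 - s) * μ ^ s),
      θ ^ (1 - s) * μ ^ s, cr, ρ'⟩ := by
  have h5 : ∀ k' : ℕ, k' < k → ∀ b : ℝ, 0 < b → b ≤ γ →
      NE5 (C := T.level k') (E k') (fun g U X => E (k' + 1) (prepend b g) U X) (Window γ) κ θ C₅ :=
    fun k' hk' b hb0 hbγ => h18 k' hk' b hb0 hbγ
  exact ne9_fadingMemory_at_level_of_ne5_below_analytic T hC hθ0 hθ1 k h5 hP hA hM hθμ hCM hr hγ hs0 hs1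


/-! ## §3 `S_N22 RRec` for every `RRec` whose bundles carry the ANALYTIC TOWER SLOT (v1.1, append-only; answers dag-ref-B READ-267's
reading pin: the closer announced in the header of v1 is supplied here, §§1–2 byte-identical) -/

/-- **`S_N22 RRec` FOR EVERY `RRec` WHOSE BUNDLES CARRY THE ANALYTIC TOWER SLOT** (refinement-generic closer; the ROAD-3 twin of
`YMDAG.N22.s_N22_of_towerSlot`): every bundle of record IS a level `k` of a tower of carriers with the ROAD-3 letters of
`n22At_level_of_n18At_below_analytic` (`ω = θ^{1−s}μ^{s}`, `Λ a i = C₉·ω^{a−i}`,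
`C₉ = (32∕(s²·min(r∕2, γ∕2)))·(2C₅∕(1−θ))^{1−s}(2M)^{s}∕ω`), node N18 holds at the levels `k′ < k` (the K4-internal edge N18 → N22 at the
run lengths below), and the level functional `E k` has (P) prefix dependence and the uniform-margin analyticity letter (A) with bounds
`M·μ^{age−1}·e^{−κd}` (`C₅ > 0`, `0 < θ < 1`, `θ ≤ μ`, `2C₅∕(1−θ) ≤ 2M`, `r > 0`, `γ > 0`, `0 < s < 1`).  It is the ∃-closure of
`n22At_level_of_n18At_below_analytic` over the record, exactly as `s_N22_of_towerSlot` is that of `n22At_level_of_n18At_below`; combine with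
`YMDAG.N22.s_N22_of_refines` to close any refinement.  No growth condition on `μ`. [folklore] -/
theorem s_N22_of_towerSlot_analytic (RRec : RateRecordPred N)
    (hslot : ∀ (F : T4Family) (D : Datum F N) (g₀ : ℕ → ℝ) (os : List (ULoop F)) (R : RateCarriers N), RRec F D g₀ os R →
      ∃ (T : TowerData) (E : ℕ → (ℕ → ℝ) → T.B → T.Dom → ℝ) (γ κ θ C₅ M μ r s cr ρ' : ℝ) (k : ℕ),
        R.u3 = ⟨T.level k, Window γ, γ, κ, E k, fun b g U X => E (k + 1) (prepend b g) U X, θ, C₅,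
          fun a i => 32 / (s ^ 2 * min (r / 2) (γ / 2)) * ((2 * C₅ / (1 - θ)) ^ (1 - s) * (2 * M) ^ s) / (θ ^ (1 - s) * μ ^ s)
            * (θ ^ (1 - s) * μ ^ s) ^ (a - i),
          32 / (s ^ 2 * min (r / 2) (γ / 2)) * ((2 * C₅ / (1 - θ)) ^ (1 - s) * (2 * M) ^ s) / (θ ^ (1 - s) * μ ^ s),
          θ ^ (1 - s) * μ ^ s, cr, ρ'⟩ ∧
        0 < C₅ ∧ 0 < θ ∧ θ < 1 ∧
        (∀ k' : ℕ, k' < k →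
          N18At ⟨T.level k', Window γ, γ, κ, E k', fun b g U X => E (k' + 1) (prepend b g) U X, θ, C₅,
            fun a i => 32 / (s ^ 2 * min (r / 2) (γ / 2)) * ((2 * C₅ / (1 - θ)) ^ (1 - s) * (2 * M) ^ s) / (θ ^ (1 - s) * μ ^ s)
              * (θ ^ (1 - s) * μ ^ s) ^ (a - i),
            32 / (s ^ 2 * min (r / 2) (γ / 2)) * ((2 * C₅ / (1 - θ)) ^ (1 - s) * (2 * M) ^ s) / (θ ^ (1 - s) * μ ^ s),
            θ ^ (1 - s) * μ ^ s, cr, ρ'⟩) ∧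
        PrefixDependenceOn (C := T.level k) (E k) (Window γ) ∧
        (∀ g ∈ Window γ, ∀ (U : (T.level k).BgA) (X : (T.level k).Dom) (i : ℕ), i < (T.level k).scale X →
          ∃ (Fz : ℂ → ℂ) (Dset : Set ℂ), DifferentiableOn ℂ Fz Dset ∧
            (∀ z ∈ Dset, ‖Fz z‖ ≤ M * μ ^ ((T.level k).scale X - 1 - i) * Real.exp (-(κ * (T.level k).d X))) ∧
            (∀ t ∈ Ioc (0 : ℝ) γ, closedBall (t : ℂ) r ⊆ Dset) ∧
            (∀ t ∈ Ioc (0 : ℝ) γ, Fz t = (E k (Function.update g i t) U X : ℂ))) ∧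
        0 < M ∧ θ ≤ μ ∧ 2 * C₅ / (1 - θ) ≤ 2 * M ∧ 0 < r ∧ 0 < γ ∧ 0 < s ∧ s < 1) :
    S_N22 RRec := by
  intro F D g₀ os R hR
  obtain ⟨T, E, γ, κ, θ, C₅, M, μ, r, s, cr, ρ', k, hu, hC, hθ0, hθ1, h18, hP, hA, hM, hθμ, hCM, hr, hγ, hs0, hs1⟩ :=
    hslot F D g₀ os R hR
  rw [hu]
  exact n22At_level_of_n18At_below_analytic T E hC hθ0 hθ1 k h18 hP hA hM hθμ hCM hr hγ hs0 hs1

end YMDAG.N22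

end
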